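import Summits.CriticalPhenomena.Ising3DConformalLimit.Theses.PerfectScreening
import Summits.CriticalPhenomena.Ising3DConformalLimit.Theses.LeeYangGap
import Literature.Barriers.CriticalPhenomena.IsingTrivialityFromDimensionFourProofs
import Summits.CriticalPhenomena.Ising3DConformalLimit.Theorems.PerfectScreeningCoulombImpliesNontrivialBlockLaw
import Summits.CriticalPhenomena.Ising3DConformalLimit.Theorems.PerfectScreeningCoulombImpliesNontrivialLeeYangPackage
import Summits.CriticalPhenomena.Ising3DConformalLimit.Theorems.PerfectScreeningCoulombImpliesNontrivialBlockFieldDomination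
import Summits.CriticalPhenomena.Ising3DConformalLimit.Theorems.PerfectScreeningCoulombImpliesNontrivialBlockVariance
import Summits.CriticalPhenomena.Ising3DConformalLimit.Theorems.PerfectScreeningCoulombImpliesNontrivialIsothermForcesGap
import Summits.CriticalPhenomena.Ising3DConformalLimit.Theorems.PerfectScreeningCoulombImpliesNontrivialGaussianKillsBinder
import Summits.CriticalPhenomena.Ising3DConformalLimit.Theorems.PerfectScreeningCoulombImpliesNontrivialUpperIsothermOfSusceptibility
import Summits.CriticalPhenomena.Ising3DConformalLimit.Theorems.PerfectScreeningCoulombImpliesNontrivialIsothermOfOneArm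
import Summits.CriticalPhenomena.Ising3DConformalLimit.Theorems.PerfectScreeningCoulombImpliesNontrivialSusceptibilityOfIsotherm
import Summits.CriticalPhenomena.Ising3DConformalLimit.Theorems.PerfectScreeningCoulombImpliesNontrivialLowerIsotherm
import Summits.CriticalPhenomena.Ising3DConformalLimit.Theorems.PerfectScreeningCoulombImpliesNontrivialTiltedMeanBelowFirstZero
import Summits.CriticalPhenomena.Ising3DConformalLimit.Theorems.PerfectScreeningCoulombImpliesNontrivialSuperIsothermOfVanishingBinder
import Summits.CriticalPhenomena.Ising3DConformalLimit.Theorems.PerfectScreeningCoulombImpliesNontrivialGapOfBinder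
import Summits.CriticalPhenomena.Ising3DConformalLimit.Theorems.LeeYangGapMonotonicityTransfer
import Summits.CriticalPhenomena.Ising3DConformalLimit.Theorems.LeeYangGapFirstZeroAntitoneInBeta

/-!
# Line `SketchPub` (isotherm-zero-count) for crux `CoulombImpliesNontrivial` — lead's skeleton (v13, lead c4: G integrated from p120922; ONE sorry = R)

Crux item stmt-CriticalPhenomena-13885 (route PerfectScreening, r3):
`Coulomb lower bound c/‖x‖ ≤ G ⟹ every non-degenerate pointwise scaling limit of criticalCorr 3
has U₄ ≢ 0`.

LINE (idea card `isotherm-zero-count`): Lee–Yang structure of the CRITICAL BLOCK SPIN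
`M_L = Σ_{x ∈ box 3 L} σ_x` in the infinite-volume state `⟨·⟩ = plusExpect 3 β_c 0`.
LANDED pieces (leads 0/c1): S1a `stub_blockLaw` (the law of `M_L` is a Lee–Yang pmf), S1b
`stub_leeYangPackage` (Newman's product formulas, tilted mean, `u₂ = m + 2Σbᵢ`, coefficient
inequality, first-zero bound `12/θ⁴ ≤ -u₄`), S3 `stub_blockFieldDomination` (GKS), S4 `stub_blockVariance`
(`cL⁵ ≤ Σ_L ≤ CL⁵` under Coulomb), S5 `stub_isothermForcesGap` (UCI ∀h ⟹ a zero at the fluctuation scale,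
∀ large L), S7 `stub_gaussianKillsBinder` (non-degenerate Gaussian limit ⟹ block Binder cumulant `g_L → 0`),
and the entrances/sharpness of the old residual S6 = UCI (`stub_upperIsothermOfSusceptibility`,
`stub_susceptibilityOfIsotherm`, `stub_isothermOfOneArm`, `stub_lowerCriticalIsotherm`).

RESHAPE (v7, lead c2). The composition only needs an isotherm bound UNDER THE CONTRADICTION HYPOTHESIS
(Coulomb ∧ a non-degenerate Gaussian limit), and that hypothesis gives `g_L → 0` (S7), hence by Newman's
first-zero bound `b_max(L)/Σ_L → 0` (every Lee–Yang mode is `o(Σ_L)`), hence Gaussian linear response of the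
block to a block field up to `t√Σ_L → ∞`, hence (S3, S4) a SUPER-isotherm `m(β_c,h)·h^{-1/5} → ∞`. So S5/S6
leave the composition and the residual WEAKENS from UCI-for-all-small-h to UCI ALONG ONE SEQUENCE:
* `stub_tiltedMeanBelowFirstZero` (T1a, NEW, LANDED p110646: real analysis on one package) — for a package whose
  cosine transform obeys Newman's bound `12/θ⁴ ≤ K` at its zeros, `bᵢ ≤ (π²/4)√(K/12)`, and for
  `0 ≤ t ≤ 1`, `π²√(K/12) sinh² t ≤ 2`: tilted mean `≥ t(m + 2Σbᵢ)/2`.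
* `stub_superIsothermOfVanishingBinder` (T1b, NEW, LANDED p110828: bookkeeping) — T1a-shape linear response + S3 +
  S4 + `K_L/Σ_L² → 0` ⟹ `∀ A, m(h) > A h^{1/5}` for all small `h`.
* `stub_upperCriticalIsothermFrequently` (R, THE RESIDUAL, the only open stub; lead) — Coulomb ⟹
  `∃ A, ∃ᶠ h → 0⁺, m(β_c,h) ≤ A h^{1/5}` (`liminf_{h→0⁺} m·h^{-1/5} < ∞`; "δ ≤ 5 with amplitude along a
  sequence"; implied by the old S6, hence by ARM / the field form; Fisher-sharp by `stub_lowerCriticalIsotherm`).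
Composition `CoulombImpliesNontrivial_of`: Coulomb + a non-degenerate limit with `U₄ ≡ 0` ⟹ `g_L → 0` (S4, S7) ⟹
super-isotherm (T1a, T1b, package, S3) ⟹ contradicts R. Zero-field reading of the residual (glue
`binderNonvanishing_of_upperIsothermFrequently`): R ⟹ `¬(g_L → 0)`, i.e. after S7 the crux IS "under Coulomb the
critical block spin is not asymptotically Gaussian"; the random-current entrance to the same statement is the
neighbouring crux file's `IsingEuclidUpgradeR4NonGaussian.Disproof.of_latticeU4RatioPositiveSeq` (+ `crux_iff`).

SUBSUMPTION (v9): the crux is also implied by the EXISTING open crux of route LeeYangGap,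
`LeeYangGap.NearCriticalLeeYangGap` (stmt-CriticalPhenomena-4945: a zero of `⟨cos θM_L⟩_β`, `β ≤ β_c`, at the
critical fluctuation scale along a sequence of `L`), via the PROVED items 4947 (`firstZeroAntitoneInBeta_proof`,
Camia–Jiang–Newman 2023 Thm 2) and 4948 (`monotonicityTransfer_proof`) + S4 + S7 + Newman's bound — registered
assembly stub `stub_cruxOfNearCriticalLeeYangGap` (LANDED p115337, Theorems/PerfectScreeningCoulombImpliesNontrivialOfLeeYangGap.lean). The `β = β_c` content of 4945
is exactly `¬(g_L → 0)`, which the residual R implies (`binderNonvanishing_of_upperIsothermFrequently`): R is an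
isotherm-language SUFFICIENT condition for 4945@β_c, and 4945 is the weakest existing item closing this line.

Disproof used: `Disproof.not_twoPointOnly` / `not_latticeShadow` (the proof must use Ising structure:
here Lee–Yang + GKS, i.e. `σ² = 1`, in S1a/S3 and in any proof of R); `cruxAt_iff_noLimit_of_five_le`
(d-specificity sits in R: δ = 3 ≠ 5 in d ≥ 5 where Coulomb_d, LY, GHS, GKS all hold); `canonical_of_coulomb`
not needed.
-/

noncomputable section

namespace Summit.CriticalPhenomena.Ising3DConformalLimit.Cruxes.CoulombImpliesNontrivial.SketchPub

open Literature.Probability.LatticeModels Filter Set Finset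
open scoped Topology BigOperators

/-! ## Registered stubs -/

/-- S1a — THE CRITICAL BLOCK-SPIN LAW IS A LEE–YANG PMF. For every `L`, with `K = (2L+1)³` and
`M_L = Σ_{x ∈ box 3 L} σ_x`: there is `p : ℤ → ℝ`, `p ≥ 0`, symmetric, vanishing off the parity class of
`K`, of total mass `1` on `[-K, K]`, such that `⟨f(M_L)⟩_{β_c} = Σ_{|k| ≤ K} p_k f(k)` for EVERY
`f : ℝ → ℝ` (the plus state is linear on local observables and `M_L ∈ [-K,K] ∩ (K + 2ℤ)` pointwise), and
the Laplace transform `z ↦ Σ p_k e^{zk}` has only purely imaginary zeros (Lee–Yang for free boxes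
`Λ_M ⊇ box 3 L` with weights `1_{box 3 L}` — tree `lee_yang_ising_holds` /
`NewmanLeeYang.sum_weight_mul_exp_ne_zero` — then `M → ∞`: at `β_c(3)` the free-box states converge to
`plusExpect` since `m*(β_c) = 0`; closedness of "roots on the unit circle" for polynomials of fixed degree,
or `hasLeeYangProperty_of_isIsingLimitLaw_holds`). -/
theorem stub_blockLaw :
    ∀ L : ℕ, ∃ p : ℤ → ℝ, (∀ k, 0 ≤ p k) ∧ (∀ k, p (-k) = p k) ∧
      (∀ k : ℤ, ¬ (2 ∣ (k + ((2 * L + 1) ^ 3 : ℕ))) → p k = 0) ∧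
      (∑ k ∈ Finset.Icc (-(((2 * L + 1) ^ 3 : ℕ) : ℤ)) ((2 * L + 1) ^ 3 : ℕ), p k = 1) ∧
      (∀ f : ℝ → ℝ, plusExpect 3 (criticalBeta 3) 0 (fun σ => f (∑ x ∈ box 3 L, spinAt x σ)) =
        ∑ k ∈ Finset.Icc (-(((2 * L + 1) ^ 3 : ℕ) : ℤ)) ((2 * L + 1) ^ 3 : ℕ), p k * f k) ∧
      (∀ z : ℂ, (∑ k ∈ Finset.Icc (-(((2 * L + 1) ^ 3 : ℕ) : ℤ)) ((2 * L + 1) ^ 3 : ℕ),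
          (p k : ℂ) * Complex.exp (z * (k : ℂ))) = 0 → z.re = 0) :=
  Summit.CriticalPhenomena.Ising3DConformalLimit.PerfectScreeningCoulombImpliesNontrivial.stub_blockLaw

/-- S1b — NEWMAN'S LEE–YANG PACKAGE FOR A LATTICE LAW (pure finite algebra; Newman, CMP 41 (1975) Thm 4 /
Prop. 2 on the lattice, template `Literature.Barriers.CriticalPhenomena.NewmanLeeYang.*`). A symmetric pmf
`p` on `[-K,K] ∩ (K + 2ℤ)` whose Laplace transform has only imaginary zeros factorises:
`Σ p_k cos(θk) = cos^m θ ∏ᵢ (1 - bᵢ sin² θ)`, `Σ p_k e^{tk} = cosh^m t ∏ᵢ (1 + bᵢ sinh² t)` with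
`bᵢ ≥ 1` (`m` = multiplicity of the root `-1`, `bᵢ = 1/sin²(αᵢ/2)` for the conjugate root pairs
`e^{±iαᵢ}` of the generating polynomial, `m + 2n = deg ≤ K`); hence the tilted mean, `u₂ = m + 2Σbᵢ`,
Newman's coefficient inequality `2m + 12Σbᵢ² - 8Σbᵢ ≤ 3u₂² - u₄'` (`u₄' = Σ p_k k⁴`), and Newman's
first-zero bound `12/θ⁴ ≤ 3u₂² - Σ p_k k⁴` at every zero `θ > 0` of `Σ p_k cos(θk)` (via the
elementary `12/sin⁴θ - 8/sin²θ ≥ 12/θ⁴` on `(0, π/2]`). -/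
theorem stub_leeYangPackage :
    ∀ (K : ℕ) (p : ℤ → ℝ), (∀ k, 0 ≤ p k) → (∀ k, p (-k) = p k) →
      (∀ k : ℤ, ¬ (2 ∣ (k + K)) → p k = 0) →
      (∑ k ∈ Finset.Icc (-(K : ℤ)) K, p k = 1) →
      (∀ z : ℂ, (∑ k ∈ Finset.Icc (-(K : ℤ)) K, (p k : ℂ) * Complex.exp (z * (k : ℂ))) = 0 → z.re = 0) →
      ∃ (m n : ℕ) (b : Fin n → ℝ), (∀ i, 1 ≤ b i) ∧ (m + 2 * n ≤ K) ∧
        (∀ θ : ℝ, ∑ k ∈ Finset.Icc (-(K : ℤ)) K, p k * Real.cos (θ * k) =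
          Real.cos θ ^ m * ∏ i, (1 - b i * Real.sin θ ^ 2)) ∧
        (∀ t : ℝ, ∑ k ∈ Finset.Icc (-(K : ℤ)) K, p k * Real.exp (t * k) =
          Real.cosh t ^ m * ∏ i, (1 + b i * Real.sinh t ^ 2)) ∧
        (∀ t : ℝ, ∑ k ∈ Finset.Icc (-(K : ℤ)) K, p k * (k * Real.exp (t * k)) =
          (Real.cosh t ^ m * ∏ i, (1 + b i * Real.sinh t ^ 2)) *
            (m * Real.tanh t + ∑ i, 2 * b i * Real.sinh t * Real.cosh t / (1 + b i * Real.sinh t ^ 2))) ∧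
        ((m : ℝ) + 2 * ∑ i, b i = ∑ k ∈ Finset.Icc (-(K : ℤ)) K, p k * (k : ℝ) ^ 2) ∧
        (2 * (m : ℝ) + 12 * ∑ i, b i ^ 2 - 8 * ∑ i, b i ≤
          3 * (∑ k ∈ Finset.Icc (-(K : ℤ)) K, p k * (k : ℝ) ^ 2) ^ 2 -
            ∑ k ∈ Finset.Icc (-(K : ℤ)) K, p k * (k : ℝ) ^ 4) ∧
        (∀ θ : ℝ, 0 < θ → ∑ k ∈ Finset.Icc (-(K : ℤ)) K, p k * Real.cos (θ * k) = 0 →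
          12 / θ ^ 4 ≤ 3 * (∑ k ∈ Finset.Icc (-(K : ℤ)) K, p k * (k : ℝ) ^ 2) ^ 2 -
            ∑ k ∈ Finset.Icc (-(K : ℤ)) K, p k * (k : ℝ) ^ 4) :=
  Summit.CriticalPhenomena.Ising3DConformalLimit.PerfectScreeningCoulombImpliesNontrivial.stub_leeYangPackage

/-- S3 — BLOCK-FIELD DOMINATION (GKS II): switching the field `h ≥ 0` on inside the block only
magnetises the block at most as much as the homogeneous field does,
`⟨M_L e^{β_c h M_L}⟩_{β_c,0} ≤ (2L+1)³ · m(β_c, h) · ⟨e^{β_c h M_L}⟩_{β_c,0}`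
(tree field convention `exp(β Σσσ + β h Σσ)`; finite volume: Griffiths II monotonicity in site fields with
plus boundary condition, then `M → ∞` and translation invariance `⟨σ_x⟩⁺_{β,h} = m(β,h)`). -/
theorem stub_blockFieldDomination :
    ∀ (L : ℕ) (h : ℝ), 0 ≤ h →
      plusExpect 3 (criticalBeta 3) 0
          (fun σ => (∑ x ∈ box 3 L, spinAt x σ) *
            Real.exp (criticalBeta 3 * h * ∑ x ∈ box 3 L, spinAt x σ))
        ≤ (2 * L + 1) ^ 3 * magnetizationInField 3 (criticalBeta 3) h *
          plusExpect 3 (criticalBeta 3) 0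
            (fun σ => Real.exp (criticalBeta 3 * h * ∑ x ∈ box 3 L, spinAt x σ)) :=
  Summit.CriticalPhenomena.Ising3DConformalLimit.PerfectScreeningCoulombImpliesNontrivial.stub_blockFieldDomination

/-- S4 — THE CRITICAL BLOCK VARIANCE UNDER COULOMB: `c L⁵ ≤ Σ_L = ⟨M_L²⟩_{β_c} ≤ C L⁵` for `L ≥ 1`
(`Σ_L = Σ_{x,y ∈ box} ⟨σ₀σ_{y-x}⟩` by linearity `plusExpect_sum_spinProduct` and translation invariance
`criticalCorr_two_pair`; the upper bound from the tree's infrared bound `criticalTwoPoint_bounds_holds`,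
the lower bound from the Coulomb hypothesis; lattice sums `Σ_{x ≠ y ∈ box L} ‖x-y‖_∞⁻¹ ≍ L⁵`). -/
theorem stub_blockVariance :
    (∃ c : ℝ, 0 < c ∧ ∀ x : Site 3, x ≠ 0 → c / ‖x‖ ≤ criticalTwoPoint 3 x) →
      ∃ c C : ℝ, 0 < c ∧ ∀ L : ℕ, 1 ≤ L →
        c * (L : ℝ) ^ 5 ≤ plusExpect 3 (criticalBeta 3) 0 (fun σ => (∑ x ∈ box 3 L, spinAt x σ) ^ 2) ∧
        plusExpect 3 (criticalBeta 3) 0 (fun σ => (∑ x ∈ box 3 L, spinAt x σ) ^ 2) ≤ C * (L : ℝ) ^ 5 :=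
  Summit.CriticalPhenomena.Ising3DConformalLimit.PerfectScreeningCoulombImpliesNontrivial.stub_blockVariance

/-- S5 — ISOTHERM FORCES GAP (real analysis on the package): the Lee–Yang package of every critical
block (conclusion of S1a+S1b, instantiated), block-field domination (S3), the two-sided `L⁵` variance
(S4) and the critical-isotherm bound `m(β_c,h) ≤ A h^{1/5}` (S6) force, for all large `L`, a zero
`θ₁ = arcsin(b_max^{-1/2})` of `⟨cos(θ M_L)⟩` with `θ₁² Σ_L ≤ C`: counting `#{i : bᵢ sinh² t ≥ 1} ≤
t·(2L+1)³·m(β_c, t/β_c)` from the tilted mean, a layer-cake bound `Σbᵢ ≤ |B|(λ₀ + 5A' b_max^{2/5})`,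
and `Σ_L ≥ cL⁵` give `b_max ≥ c' L⁵`. -/
theorem stub_isothermForcesGap :
    (∀ L : ℕ, ∃ (m n : ℕ) (b : Fin n → ℝ), (∀ i, 1 ≤ b i) ∧ (m + 2 * n ≤ (2 * L + 1) ^ 3) ∧
        (∀ θ : ℝ, plusExpect 3 (criticalBeta 3) 0 (fun σ => Real.cos (θ * ∑ x ∈ box 3 L, spinAt x σ)) =
          Real.cos θ ^ m * ∏ i, (1 - b i * Real.sin θ ^ 2)) ∧
        (∀ t : ℝ, plusExpect 3 (criticalBeta 3) 0 (fun σ => Real.exp (t * ∑ x ∈ box 3 L, spinAt x σ)) =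
          Real.cosh t ^ m * ∏ i, (1 + b i * Real.sinh t ^ 2)) ∧
        (∀ t : ℝ, plusExpect 3 (criticalBeta 3) 0
            (fun σ => (∑ x ∈ box 3 L, spinAt x σ) * Real.exp (t * ∑ x ∈ box 3 L, spinAt x σ)) =
          (Real.cosh t ^ m * ∏ i, (1 + b i * Real.sinh t ^ 2)) *
            (m * Real.tanh t + ∑ i, 2 * b i * Real.sinh t * Real.cosh t / (1 + b i * Real.sinh t ^ 2))) ∧
        ((m : ℝ) + 2 * ∑ i, b i = plusExpect 3 (criticalBeta 3) 0 (fun σ => (∑ x ∈ box 3 L, spinAt x σ) ^ 2))) →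
    (∀ (L : ℕ) (h : ℝ), 0 ≤ h →
      plusExpect 3 (criticalBeta 3) 0
          (fun σ => (∑ x ∈ box 3 L, spinAt x σ) *
            Real.exp (criticalBeta 3 * h * ∑ x ∈ box 3 L, spinAt x σ))
        ≤ (2 * L + 1) ^ 3 * magnetizationInField 3 (criticalBeta 3) h *
          plusExpect 3 (criticalBeta 3) 0
            (fun σ => Real.exp (criticalBeta 3 * h * ∑ x ∈ box 3 L, spinAt x σ))) →
    (∃ c C : ℝ, 0 < c ∧ ∀ L : ℕ, 1 ≤ L →
        c * (L : ℝ) ^ 5 ≤ plusExpect 3 (criticalBeta 3) 0 (fun σ => (∑ x ∈ box 3 L, spinAt x σ) ^ 2) ∧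
        plusExpect 3 (criticalBeta 3) 0 (fun σ => (∑ x ∈ box 3 L, spinAt x σ) ^ 2) ≤ C * (L : ℝ) ^ 5) →
    (∃ A h₀ : ℝ, 0 < h₀ ∧ ∀ h : ℝ, 0 < h → h ≤ h₀ →
        magnetizationInField 3 (criticalBeta 3) h ≤ A * h ^ ((1:ℝ) / 5)) →
    ∃ C : ℝ, ∃ L₀ : ℕ, ∀ L : ℕ, L₀ ≤ L → ∃ θ : ℝ, 0 < θ ∧
      θ ^ 2 * plusExpect 3 (criticalBeta 3) 0 (fun σ => (∑ x ∈ box 3 L, spinAt x σ) ^ 2) ≤ C ∧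
      plusExpect 3 (criticalBeta 3) 0 (fun σ => Real.cos (θ * ∑ x ∈ box 3 L, spinAt x σ)) = 0 :=
  Summit.CriticalPhenomena.Ising3DConformalLimit.PerfectScreeningCoulombImpliesNontrivial.stub_isothermForcesGap

/-- T1a (NEW, lead c2; LANDED p110646 — real analysis on ONE Lee–Yang package) — LINEAR RESPONSE BELOW THE
FIRST ZERO. For a package `(m, b₁…b_n)` with `bᵢ ≥ 1` whose cosine transform `cos^m θ ∏ᵢ(1 - bᵢ sin² θ)`
obeys Newman's first-zero bound `12/θ⁴ ≤ K` at each of its zeros `θ > 0`: every mode is small,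
`bᵢ ≤ (π²/4)·√(K/12)` (the zero `θᵢ = arcsin bᵢ^{-1/2} ∈ (0, π/2]` and Jordan's inequality
`sin θ ≥ 2θ/π`, Mathlib `Real.two_div_pi_mul_le_sin`), hence for `0 ≤ t ≤ 1` with
`π²·√(K/12)·sinh² t ≤ 2` (so that `bᵢ sinh² t ≤ 1/2`) the tilted mean is at least half the linear
response: `t(m + 2Σbᵢ)/2 ≤ m tanh t + Σᵢ 2bᵢ sinh t cosh t/(1 + bᵢ sinh² t)`
(`tanh t ≥ t/2` on `[0,1]` since `cosh 1 < 2`; `sinh t cosh t ≥ t`; `1 + bᵢ sinh² t ≤ 3/2`). -/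
theorem stub_tiltedMeanBelowFirstZero :
    ∀ (m n : ℕ) (b : Fin n → ℝ) (K t : ℝ), (∀ i, 1 ≤ b i) →
      (∀ θ : ℝ, 0 < θ → Real.cos θ ^ m * ∏ i, (1 - b i * Real.sin θ ^ 2) = 0 → 12 / θ ^ 4 ≤ K) →
      0 ≤ t → t ≤ 1 → Real.pi ^ 2 * Real.sqrt (K / 12) * Real.sinh t ^ 2 ≤ 2 →
      t * ((m : ℝ) + 2 * ∑ i, b i) / 2 ≤
        m * Real.tanh t + ∑ i, 2 * b i * Real.sinh t * Real.cosh t / (1 + b i * Real.sinh t ^ 2) :=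
  -- LANDED p110646
  Summit.CriticalPhenomena.Ising3DConformalLimit.PerfectScreeningCoulombImpliesNontrivial.stub_tiltedMeanBelowFirstZero

/-- T1b (NEW, lead c2; LANDED p110828 — bookkeeping) — SUPER-ISOTHERM FROM A VANISHING BLOCK BINDER CUMULANT.
Abstract data: `β > 0`; `V L` (block variance `Σ_L`), `K L` (`= 3Σ_L² − ⟨M_L⁴⟩ = −u₄(M_L)`), `mag` (the
magnetisation `h ↦ m(β_c,h)`), `Eexp L t > 0` (block mgf `⟨e^{tM_L}⟩`) and `Etilt L t` (`⟨M_L e^{tM_L}⟩`),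
with: (T1a-shape) for `0 ≤ t ≤ 1` and `π²√(K L/12) sinh² t ≤ 2`, `t·V L/2 ≤ Etilt L t / Eexp L t`; (GKS, S3)
`Etilt L (βh) ≤ (2L+1)³·mag h·Eexp L (βh)` for `h ≥ 0`; (Var, S4) `cL⁵ ≤ V L ≤ CL⁵` for `L ≥ 1`;
(S7) `K L / (V L)² → 0`. Then `mag h · h^{-1/5} → ∞`: for every `A` there is `h₀ > 0` with
`A·h^{1/5} < mag h` on `(0, h₀]`. (Given `A`, put `t = βh` and `L = ⌈κ t^{-2/5}⌉₊` with
`κ ≥ 1`, `κ² > 54·A·β^{-1/5}/c`; for `t ≤ 1`, `κ t^{-2/5} ≥ 1` so `L ≤ 2κ t^{-2/5}` and `L⁵t² ≤ 32κ⁵`;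
`√(K L/12) ≤ √(g_L/12)·C L⁵` with `g_L := K L/(V L)² → 0` and `sinh t ≤ 2t` make the T1a condition
`π²√(K L/12) sinh² t ≤ 2` hold as soon as `g_L` is small, i.e. for `L ≥ L₁`, i.e. for `h ≤ h₀`; then
`mag h ≥ t·V L/(2(2L+1)³) ≥ (c/54)·t·L² ≥ (c/54)·κ²·t^{1/5} > A·h^{1/5}`.) -/
theorem stub_superIsothermOfVanishingBinder :
    ∀ (β : ℝ), 0 < β → ∀ (V K : ℕ → ℝ) (mag : ℝ → ℝ) (Eexp Etilt : ℕ → ℝ → ℝ),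
      (∀ (L : ℕ) (t : ℝ), 0 < Eexp L t) →
      (∀ (L : ℕ) (t : ℝ), 0 ≤ t → t ≤ 1 → Real.pi ^ 2 * Real.sqrt (K L / 12) * Real.sinh t ^ 2 ≤ 2 →
        t * V L / 2 ≤ Etilt L t / Eexp L t) →
      (∀ (L : ℕ) (h : ℝ), 0 ≤ h → Etilt L (β * h) ≤ (2 * L + 1) ^ 3 * mag h * Eexp L (β * h)) →
      (∃ c C : ℝ, 0 < c ∧ ∀ L : ℕ, 1 ≤ L → c * (L : ℝ) ^ 5 ≤ V L ∧ V L ≤ C * (L : ℝ) ^ 5) →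
      Tendsto (fun L : ℕ => K L / (V L) ^ 2) atTop (𝓝 0) →
      ∀ A : ℝ, ∃ h₀ : ℝ, 0 < h₀ ∧ ∀ h : ℝ, 0 < h → h ≤ h₀ → A * h ^ ((1:ℝ) / 5) < mag h :=
  -- LANDED p110828
  Summit.CriticalPhenomena.Ising3DConformalLimit.PerfectScreeningCoulombImpliesNontrivial.stub_superIsothermOfVanishingBinder

/-- R — THE RESIDUAL (registered stub `stub_upperCriticalIsothermFrequently`, the only OPEN stub of the line,
lead c2): THE UPPER CRITICAL ISOTHERM ALONG ONE SEQUENCE OF FIELDS, UNDER COULOMB —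
`∃ A, ∃ h_k → 0⁺, m(β_c(3), h_k) ≤ A·h_k^{1/5}`, i.e. `liminf_{h→0⁺} m(β_c,h)·h^{-1/5} < ∞` ("δ ≤ 5 with
amplitude along a sequence" = the Buckingham–Gunton / magnetic-hyperscaling EQUALITY direction at `η = 0`,
in liminf form). Strictly weaker than the v4–v6 residual S6 (`∀ 0 < h ≤ h₀`, glue
`upperIsothermFrequently_of_upperIsotherm`), hence implied by each landed entrance to S6 (one-arm bound
`⟨σ₀⟩⁺_{box L;β_c} ≤ C L^{-1/2}`, `stub_isothermOfOneArm`; field form `χ_Λ(h)·m(h)⁴ ≤ C`,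
`stub_upperIsothermOfSusceptibility`); Fisher-sharp (`stub_lowerCriticalIsotherm`: `m ≥ c h^{1/5}` under
Coulomb). OPEN (hyperscaling strength; d-specific: false in `d ≥ 5`, where Coulomb_d holds and `δ = 3`; no
printed upper bound on the `d = 3` critical isotherm, FFS92 Table 14.2). Zero-field meaning: by T1 it says
exactly that the critical block Binder cumulant does not tend to `0` under Coulomb
(`binderNonvanishing_of_upperIsothermFrequently`). -/
theorem stub_upperCriticalIsothermFrequently :
    (∃ c : ℝ, 0 < c ∧ ∀ x : Site 3, x ≠ 0 → c / ‖x‖ ≤ criticalTwoPoint 3 x) →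
      ∃ A : ℝ, ∃ᶠ h in 𝓝[>] (0:ℝ),
        magnetizationInField 3 (criticalBeta 3) h ≤ A * h ^ ((1:ℝ) / 5) := by
  sorry

/-- G (lead c3; LANDED p120922, `Theorems/PerfectScreeningCoulombImpliesNontrivialGapOfBinder.lean`) —
B ⟹ GAP: if the critical block Binder cumulant `g_L = (3Σ_L² − ⟨M_L⁴⟩)/Σ_L²` does NOT tend to zero, then the
EXISTING open crux `LeeYangGap.NearCriticalLeeYangGap` (stmt-CriticalPhenomena-4945) holds (at `β = β_c`, zero
`θ₁ = arcsin(b_max^{-1/2})` with `θ₁²Σ_L ≤ 3π²/(2ε)` where `g_L ≥ ε`; needs the REVERSE Newman inequality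
`3u₂² − Σp_k k⁴ ≤ 2m + 12Σbᵢ² − 8Σbᵢ`, proved there by comparing sharp fourth-order expansions of `2 log M`).
With `binderNonvanishing_of_upperIsothermFrequently` (R ⟹ B) this orders the two open items that close the line:
under Coulomb, R ⟹ 4945 (`nearCriticalLeeYangGap_of_upperIsothermFrequently` below), and 4945 ⟹ crux is landed
(p115337): the crux, via this line, is literally downstream of 4945. -/
theorem stub_gapOfBinderNonvanishing :
    (¬ Tendsto (fun L : ℕ =>
        (3 * (plusExpect 3 (criticalBeta 3) 0 (fun σ => (∑ x ∈ box 3 L, spinAt x σ) ^ 2)) ^ 2 -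
            plusExpect 3 (criticalBeta 3) 0 (fun σ => (∑ x ∈ box 3 L, spinAt x σ) ^ 4)) /
          (plusExpect 3 (criticalBeta 3) 0 (fun σ => (∑ x ∈ box 3 L, spinAt x σ) ^ 2)) ^ 2)
        atTop (𝓝 0)) →
    Summit.CriticalPhenomena.Ising3DConformalLimit.Theses.LeeYangGap.NearCriticalLeeYangGap :=
  -- LANDED p120922 (lead c3), Theorems/PerfectScreeningCoulombImpliesNontrivialGapOfBinder.lean
  Summit.CriticalPhenomena.Ising3DConformalLimit.PerfectScreeningCoulombImpliesNontrivial.stub_gapOfBinderNonvanishing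

/-- The v4–v6 residual S6 (UCI for all small `h`) implies the v7 residual R (UCI frequently): `𝓝[>] 0` is
non-trivial and contains `(0, h₀]`. So every landed entrance to S6 is an entrance to R. -/
theorem upperIsothermFrequently_of_upperIsotherm
    (hS6 : ∃ A h₀ : ℝ, 0 < h₀ ∧ ∀ h : ℝ, 0 < h → h ≤ h₀ →
        magnetizationInField 3 (criticalBeta 3) h ≤ A * h ^ ((1:ℝ) / 5)) :
    ∃ A : ℝ, ∃ᶠ h in 𝓝[>] (0:ℝ),
        magnetizationInField 3 (criticalBeta 3) h ≤ A * h ^ ((1:ℝ) / 5) := by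
  obtain ⟨A, h₀, hh₀, hA⟩ := hS6
  refine ⟨A, Filter.Eventually.frequently ?_⟩
  filter_upwards [Ioc_mem_nhdsGT hh₀] with h hh using hA h hh.1 hh.2

/-- S6b (landed, entrance (i) to S6) — INTEGRATING THE SUSCEPTIBILITY BOUND (fluctuation–response for the
plus state in a field + GHS): if `Σ_{x∈Λ}⟨σ₀;σ_x⟩_{β_c,h} · m(β_c,h)⁴ ≤ C` for all finite `Λ` and
`0 < h ≤ h₀`, then `m(β_c,h) ≤ A h^{1/5}` on `(0, h₀]`. -/
theorem stub_upperIsothermOfSusceptibility :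
    (∃ C h₀ : ℝ, 0 < h₀ ∧ ∀ h : ℝ, 0 < h → h ≤ h₀ → ∀ Λ : Finset (Site 3),
        (∑ x ∈ Λ, (plusExpect 3 (criticalBeta 3) h (spinPair 0 x) -
            magnetizationInField 3 (criticalBeta 3) h ^ 2)) *
          magnetizationInField 3 (criticalBeta 3) h ^ 4 ≤ C) →
      ∃ A h₀ : ℝ, 0 < h₀ ∧ ∀ h : ℝ, 0 < h → h ≤ h₀ →
        magnetizationInField 3 (criticalBeta 3) h ≤ A * h ^ ((1:ℝ) / 5) :=
  Summit.CriticalPhenomena.Ising3DConformalLimit.PerfectScreeningCoulombImpliesNontrivial.stub_upperIsothermOfSusceptibility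

/-- Converse of entrance (i) (landed, p108222): S6 ⟹ S6a by the weak GHS bound `χ_Λ(h) ≤ m(h)/(β_c h)`, so the
field form S6a and the isotherm form S6 of the residual are EQUIVALENT. -/
theorem stub_susceptibilityOfIsotherm :
    (∃ A h₀ : ℝ, 0 < h₀ ∧ ∀ h : ℝ, 0 < h → h ≤ h₀ →
        magnetizationInField 3 (criticalBeta 3) h ≤ A * h ^ ((1:ℝ) / 5)) →
      ∃ C h₀ : ℝ, 0 < h₀ ∧ ∀ h : ℝ, 0 < h → h ≤ h₀ → ∀ Λ : Finset (Site 3),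
        (∑ x ∈ Λ, (plusExpect 3 (criticalBeta 3) h (spinPair 0 x) -
            magnetizationInField 3 (criticalBeta 3) h ^ 2)) *
          magnetizationInField 3 (criticalBeta 3) h ^ 4 ≤ C :=
  Summit.CriticalPhenomena.Ising3DConformalLimit.PerfectScreeningCoulombImpliesNontrivial.stub_susceptibilityOfIsotherm

/-- Entrance (ii) to S6 (landed, p107945) — THE ONE-ARM HYPERSCALING BOUND SUFFICES: if
`⟨σ₀⟩⁺_{box L; β_c, 0} ≤ C L^{-1/2}` for all `L ≥ 1` (one-arm exponent `≥ Δ_σ = 1/2` at `η = 0`, a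
zero-field statement of the same hyperscaling strength), then `m(β_c,h) ≤ A h^{1/5}` on `(0,1]`
(`m(h) ≤ ⟨σ₀⟩⁺_{box L,h} ≤ ⟨σ₀⟩⁺_{box L,0} + β_c h Σ_{box L} G ≤ C L^{-1/2} + β_c K L² h`, `L = ⌈h^{-2/5}⌉`). -/
theorem stub_isothermOfOneArm :
    (∃ C : ℝ, ∀ L : ℕ, 1 ≤ L →
        isingExpect (zdGraph 3) (box 3 L) (criticalBeta 3) 0 .plus (spinAt 0) ≤ C * (L : ℝ) ^ (-(1:ℝ) / 2)) →
      ∃ A h₀ : ℝ, 0 < h₀ ∧ ∀ h : ℝ, 0 < h → h ≤ h₀ →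
        magnetizationInField 3 (criticalBeta 3) h ≤ A * h ^ ((1:ℝ) / 5) :=
  Summit.CriticalPhenomena.Ising3DConformalLimit.PerfectScreeningCoulombImpliesNontrivial.stub_isothermOfOneArm

/-- Sharpness of S6 (landed, p108581) — THE LOWER CRITICAL ISOTHERM UNDER COULOMB: the antecedent alone gives
the matching LOWER bound `c·h^{1/5} ≤ m(β_c,h)` ("δ ≥ 5 with amplitude at η = 0", the Buckingham–Gunton/Fisher
direction: Lee–Yang Gaussian domination `⟨e^{tM_L}⟩ ≤ e^{t²Σ_L/2}`, linear response from below
`tΣ_L ≤ ⟨M_L e^{tM_L}⟩`, S3, S4). So the residual S6 asks exactly for `m(β_c,h) ≍ h^{1/5}`. -/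
theorem stub_lowerCriticalIsotherm :
    (∃ c : ℝ, 0 < c ∧ ∀ x : Site 3, x ≠ 0 → c / ‖x‖ ≤ criticalTwoPoint 3 x) →
      ∃ c h₀ : ℝ, 0 < c ∧ 0 < h₀ ∧ ∀ h : ℝ, 0 < h → h ≤ h₀ →
        c * h ^ ((1:ℝ) / 5) ≤ magnetizationInField 3 (criticalBeta 3) h :=
  Summit.CriticalPhenomena.Ising3DConformalLimit.PerfectScreeningCoulombImpliesNontrivial.stub_lowerCriticalIsotherm

/-- S7 — A GAUSSIAN LIMIT KILLS THE BLOCK BINDER COUPLING (route LeeYangGap support 4950, in the form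
this line needs: two-sided `L⁵` block variance given, no scale covariance): if `c L⁵ ≤ Σ_L ≤ C L⁵` and
`(ρ, S)` is a non-degenerate pointwise scaling limit of `criticalCorr 3` with `U₄^S ≡ 0` on non-coincident
configurations, then `g_L = (3Σ_L² - ⟨M_L⁴⟩)/Σ_L² → 0`. (`3Σ_L² - ⟨M_L⁴⟩ = -Σ_{box⁴} U₄^{lat}`;
`|U₄^{lat}| ≤ 2·S₂S₂` for each pairing, `abs_criticalUrsellFour_le_two_mul`; ε-separated configurations
by uniform convergence on the compact `K_ε ⊂ NonCoincident` with `ρ(1/L)⁻⁴ ≲ L⁻²`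
(`exists_eventually_inv_sq_rho_le`); ε-close ones by `Σ_{‖z‖ ≤ εL} G(z) ≲ ε²L²` (infrared bound) times
`Σ_L`, against `Σ_L² ≳ L⁵ Σ_L`.) -/
theorem stub_gaussianKillsBinder :
    (∃ c C : ℝ, 0 < c ∧ ∀ L : ℕ, 1 ≤ L →
        c * (L : ℝ) ^ 5 ≤ plusExpect 3 (criticalBeta 3) 0 (fun σ => (∑ x ∈ box 3 L, spinAt x σ) ^ 2) ∧
        plusExpect 3 (criticalBeta 3) 0 (fun σ => (∑ x ∈ box 3 L, spinAt x σ) ^ 2) ≤ C * (L : ℝ) ^ 5) →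
    ∀ (ρ : ℝ → ℝ) (S : CorrFamily 3), (∀ δ ∈ Set.Ioc (0:ℝ) 1, 0 < ρ δ) →
      HasPointwiseScalingLimit (criticalCorr 3) ρ S → IsNondegenerateTwoPoint S →
      ¬ HasNontrivialU4 S →
      Tendsto (fun L : ℕ =>
        (3 * (plusExpect 3 (criticalBeta 3) 0 (fun σ => (∑ x ∈ box 3 L, spinAt x σ) ^ 2)) ^ 2 -
            plusExpect 3 (criticalBeta 3) 0 (fun σ => (∑ x ∈ box 3 L, spinAt x σ) ^ 4)) /
          (plusExpect 3 (criticalBeta 3) 0 (fun σ => (∑ x ∈ box 3 L, spinAt x σ) ^ 2)) ^ 2)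
        atTop (𝓝 0) :=
  Summit.CriticalPhenomena.Ising3DConformalLimit.PerfectScreeningCoulombImpliesNontrivial.stub_gaussianKillsBinder

/-! ## Glue (sorry-free) -/

/-- The Lee–Yang package of the critical block, assembled from S1a and S1b: product formulas, tilted
mean, variance identity, degree count, and Newman's first-zero bound, for every `L`. -/
theorem blockPackage (L : ℕ) :
    ∃ (m n : ℕ) (b : Fin n → ℝ), (∀ i, 1 ≤ b i) ∧ (m + 2 * n ≤ (2 * L + 1) ^ 3) ∧
      (∀ θ : ℝ, plusExpect 3 (criticalBeta 3) 0 (fun σ => Real.cos (θ * ∑ x ∈ box 3 L, spinAt x σ)) =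
        Real.cos θ ^ m * ∏ i, (1 - b i * Real.sin θ ^ 2)) ∧
      (∀ t : ℝ, plusExpect 3 (criticalBeta 3) 0 (fun σ => Real.exp (t * ∑ x ∈ box 3 L, spinAt x σ)) =
        Real.cosh t ^ m * ∏ i, (1 + b i * Real.sinh t ^ 2)) ∧
      (∀ t : ℝ, plusExpect 3 (criticalBeta 3) 0
          (fun σ => (∑ x ∈ box 3 L, spinAt x σ) * Real.exp (t * ∑ x ∈ box 3 L, spinAt x σ)) =
        (Real.cosh t ^ m * ∏ i, (1 + b i * Real.sinh t ^ 2)) *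
          (m * Real.tanh t + ∑ i, 2 * b i * Real.sinh t * Real.cosh t / (1 + b i * Real.sinh t ^ 2))) ∧
      ((m : ℝ) + 2 * ∑ i, b i = plusExpect 3 (criticalBeta 3) 0 (fun σ => (∑ x ∈ box 3 L, spinAt x σ) ^ 2)) ∧
      (∀ θ : ℝ, 0 < θ →
        plusExpect 3 (criticalBeta 3) 0 (fun σ => Real.cos (θ * ∑ x ∈ box 3 L, spinAt x σ)) = 0 →
        12 / θ ^ 4 ≤ 3 * (plusExpect 3 (criticalBeta 3) 0 (fun σ => (∑ x ∈ box 3 L, spinAt x σ) ^ 2)) ^ 2 -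
          plusExpect 3 (criticalBeta 3) 0 (fun σ => (∑ x ∈ box 3 L, spinAt x σ) ^ 4)) := by
  obtain ⟨p, hp0, hsymm, hpar, hmass, hlaw, hLY⟩ := stub_blockLaw L
  obtain ⟨m, n, b, hb, hdeg, hcos, hexp, htilt, hvar, -, hnewman⟩ :=
    stub_leeYangPackage ((2 * L + 1) ^ 3) p hp0 hsymm hpar hmass hLY
  refine ⟨m, n, b, hb, hdeg, fun θ => ?_, fun t => ?_, fun t => ?_, ?_, fun θ hθ hzero => ?_⟩
  · rw [hlaw (fun u => Real.cos (θ * u)), hcos]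
  · rw [hlaw (fun u => Real.exp (t * u)), hexp]
  · rw [hlaw (fun u => u * Real.exp (t * u)), htilt]
  · rw [hvar, hlaw (fun u => u ^ 2)]
  · rw [hlaw (fun u => Real.cos (θ * u))] at hzero
    rw [hlaw (fun u => u ^ 2), hlaw (fun u => u ^ 4)]
    exact hnewman θ hθ hzero

/-- The critical block variance is positive (`Σ_L ≥ ⟨σ₀²⟩ = 1`, Griffiths I; tree `blockVariance_pos`). -/
theorem blockVariance_pos' (L : ℕ) :
    0 < plusExpect 3 (criticalBeta 3) 0 (fun σ => (∑ x ∈ box 3 L, spinAt x σ) ^ 2) := by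
  simpa [Literature.Barriers.CriticalPhenomena.blockVariance,
    Literature.Barriers.CriticalPhenomena.blockSpin] using
    Literature.Barriers.CriticalPhenomena.blockVariance_pos (d := 3) (criticalBeta_nonneg 3) L

/-- A zero at the fluctuation scale and Newman's first-zero bound give a block Binder coupling
`≥ 12/C²` (kept from v6: how a Lee–Yang gap, e.g. the conclusion of S5, bounds `g_L` below). -/
theorem blockCoupling_ge {C θ V K : ℝ} (hθ : 0 < θ) (hV : 0 < V) (hθC : θ ^ 2 * V ≤ C)
    (hK : 12 / θ ^ 4 ≤ K) : 12 / C ^ 2 ≤ K / V ^ 2 := by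
  have hx : 0 < θ ^ 2 * V := by positivity
  have hC : 0 ≤ C := hx.le.trans hθC
  have h1 : (θ ^ 2 * V) ^ 2 ≤ C ^ 2 := by
    nlinarith [mul_nonneg (sub_nonneg.2 hθC) (add_nonneg hC hx.le)]
  have h2 : 12 / C ^ 2 ≤ 12 / (θ ^ 2 * V) ^ 2 :=
    div_le_div_of_nonneg_left (by norm_num) (by positivity) h1
  have h3 : (12 / θ ^ 4) / V ^ 2 = 12 / (θ ^ 2 * V) ^ 2 := by
    rw [div_div]
    congr 1
    ring
  have h4 : (12 / θ ^ 4) / V ^ 2 ≤ K / V ^ 2 := div_le_div_of_nonneg_right hK (by positivity)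
  rw [← h3] at h2
  exact h2.trans h4

/-- Route LeeYangGap's support item `NewmanFirstZeroBound` (stmt-4949) follows from the package. -/
theorem newmanFirstZeroBound_of_package :
    Summit.CriticalPhenomena.Ising3DConformalLimit.Theses.LeeYangGap.NewmanFirstZeroBound := by
  intro L θ hθ hzero
  obtain ⟨m, n, b, -, -, -, -, -, -, hN⟩ := blockPackage L
  exact hN θ hθ hzero

/-- The critical block mgf is positive: `0 < ⟨e^{tM_L}⟩ = cosh^m t ∏(1 + bᵢ sinh² t)`. -/
theorem blockMgf_pos (L : ℕ) (t : ℝ) :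
    0 < plusExpect 3 (criticalBeta 3) 0 (fun σ => Real.exp (t * ∑ x ∈ box 3 L, spinAt x σ)) := by
  obtain ⟨m, n, b, hb, -, -, hexp, -, -, -⟩ := blockPackage L
  rw [hexp t]
  refine mul_pos (pow_pos (Real.cosh_pos t) m) (Finset.prod_pos fun i _ => ?_)
  have := hb i
  positivity

/-- T1a instantiated on the critical block (glue): below the first Lee–Yang zero the tilted block mean is at
least half the linear response, `t Σ_L/2 ≤ ⟨M_L e^{tM_L}⟩/⟨e^{tM_L}⟩`, whenever `0 ≤ t ≤ 1` and
`π² √((3Σ_L² − ⟨M_L⁴⟩)/12) sinh² t ≤ 2`. -/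
theorem blockTiltedMean_ge (L : ℕ) (t : ℝ) (ht0 : 0 ≤ t) (ht1 : t ≤ 1)
    (hcond : Real.pi ^ 2 * Real.sqrt ((3 * (plusExpect 3 (criticalBeta 3) 0
        (fun σ => (∑ x ∈ box 3 L, spinAt x σ) ^ 2)) ^ 2 -
        plusExpect 3 (criticalBeta 3) 0 (fun σ => (∑ x ∈ box 3 L, spinAt x σ) ^ 4)) / 12) *
        Real.sinh t ^ 2 ≤ 2) :
    t * plusExpect 3 (criticalBeta 3) 0 (fun σ => (∑ x ∈ box 3 L, spinAt x σ) ^ 2) / 2 ≤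
      plusExpect 3 (criticalBeta 3) 0
          (fun σ => (∑ x ∈ box 3 L, spinAt x σ) * Real.exp (t * ∑ x ∈ box 3 L, spinAt x σ)) /
        plusExpect 3 (criticalBeta 3) 0 (fun σ => Real.exp (t * ∑ x ∈ box 3 L, spinAt x σ)) := by
  have hEpos := blockMgf_pos L t
  obtain ⟨m, n, b, hb, -, hcos, hexp, htilt, hvar, hN⟩ := blockPackage L
  have hzero : ∀ θ : ℝ, 0 < θ → Real.cos θ ^ m * ∏ i, (1 - b i * Real.sin θ ^ 2) = 0 →
      12 / θ ^ 4 ≤ 3 * (plusExpect 3 (criticalBeta 3) 0 (fun σ => (∑ x ∈ box 3 L, spinAt x σ) ^ 2)) ^ 2 -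
        plusExpect 3 (criticalBeta 3) 0 (fun σ => (∑ x ∈ box 3 L, spinAt x σ) ^ 4) := by
    intro θ hθ hprod
    refine hN θ hθ ?_
    rw [hcos θ, hprod]
  have hT1a := stub_tiltedMeanBelowFirstZero m n b _ t hb hzero ht0 ht1 hcond
  rw [hvar] at hT1a
  rw [hexp t] at hEpos ⊢
  rw [htilt t, mul_div_assoc]
  rw [mul_div_cancel_left₀ _ hEpos.ne']
  convert hT1a using 1
  ring

/-- THE SUPER-ISOTHERM OF A GAUSSIAN LIMIT (glue: T1b fed by T1a, the package, S3): if `cL⁵ ≤ Σ_L ≤ CL⁵` and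
the block Binder cumulant `g_L = (3Σ_L² − ⟨M_L⁴⟩)/Σ_L² → 0`, then `m(β_c,h)·h^{-1/5} → ∞` as `h → 0⁺`. -/
theorem superIsotherm_of_vanishingBinder
    (hV : ∃ c C : ℝ, 0 < c ∧ ∀ L : ℕ, 1 ≤ L →
        c * (L : ℝ) ^ 5 ≤ plusExpect 3 (criticalBeta 3) 0 (fun σ => (∑ x ∈ box 3 L, spinAt x σ) ^ 2) ∧
        plusExpect 3 (criticalBeta 3) 0 (fun σ => (∑ x ∈ box 3 L, spinAt x σ) ^ 2) ≤ C * (L : ℝ) ^ 5)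
    (htend : Tendsto (fun L : ℕ =>
        (3 * (plusExpect 3 (criticalBeta 3) 0 (fun σ => (∑ x ∈ box 3 L, spinAt x σ) ^ 2)) ^ 2 -
            plusExpect 3 (criticalBeta 3) 0 (fun σ => (∑ x ∈ box 3 L, spinAt x σ) ^ 4)) /
          (plusExpect 3 (criticalBeta 3) 0 (fun σ => (∑ x ∈ box 3 L, spinAt x σ) ^ 2)) ^ 2)
        atTop (𝓝 0)) :
    ∀ A : ℝ, ∃ h₀ : ℝ, 0 < h₀ ∧ ∀ h : ℝ, 0 < h → h ≤ h₀ →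
      A * h ^ ((1:ℝ) / 5) < magnetizationInField 3 (criticalBeta 3) h :=
  stub_superIsothermOfVanishingBinder (criticalBeta 3) (criticalBeta_pos_holds (d := 3) (by norm_num))
    (fun L => plusExpect 3 (criticalBeta 3) 0 (fun σ => (∑ x ∈ box 3 L, spinAt x σ) ^ 2))
    (fun L => 3 * (plusExpect 3 (criticalBeta 3) 0 (fun σ => (∑ x ∈ box 3 L, spinAt x σ) ^ 2)) ^ 2 -
      plusExpect 3 (criticalBeta 3) 0 (fun σ => (∑ x ∈ box 3 L, spinAt x σ) ^ 4))
    (magnetizationInField 3 (criticalBeta 3))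
    (fun L t => plusExpect 3 (criticalBeta 3) 0 (fun σ => Real.exp (t * ∑ x ∈ box 3 L, spinAt x σ)))
    (fun L t => plusExpect 3 (criticalBeta 3) 0
      (fun σ => (∑ x ∈ box 3 L, spinAt x σ) * Real.exp (t * ∑ x ∈ box 3 L, spinAt x σ)))
    blockMgf_pos blockTiltedMean_ge
    (fun L h hh => stub_blockFieldDomination L h hh) hV htend

/-- ZERO-FIELD READING OF THE RESIDUAL (glue): under the two-sided block variance, R (UCI along a sequence)
says exactly that the critical block Binder cumulant does NOT tend to zero. -/
theorem binderNonvanishing_of_upperIsothermFrequently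
    (hV : ∃ c C : ℝ, 0 < c ∧ ∀ L : ℕ, 1 ≤ L →
        c * (L : ℝ) ^ 5 ≤ plusExpect 3 (criticalBeta 3) 0 (fun σ => (∑ x ∈ box 3 L, spinAt x σ) ^ 2) ∧
        plusExpect 3 (criticalBeta 3) 0 (fun σ => (∑ x ∈ box 3 L, spinAt x σ) ^ 2) ≤ C * (L : ℝ) ^ 5)
    (hR : ∃ A : ℝ, ∃ᶠ h in 𝓝[>] (0:ℝ),
        magnetizationInField 3 (criticalBeta 3) h ≤ A * h ^ ((1:ℝ) / 5)) :
    ¬ Tendsto (fun L : ℕ =>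
        (3 * (plusExpect 3 (criticalBeta 3) 0 (fun σ => (∑ x ∈ box 3 L, spinAt x σ) ^ 2)) ^ 2 -
            plusExpect 3 (criticalBeta 3) 0 (fun σ => (∑ x ∈ box 3 L, spinAt x σ) ^ 4)) /
          (plusExpect 3 (criticalBeta 3) 0 (fun σ => (∑ x ∈ box 3 L, spinAt x σ) ^ 2)) ^ 2)
        atTop (𝓝 0) := by
  intro htend
  obtain ⟨A, hfreq⟩ := hR
  obtain ⟨h₀, hh₀, hsuper⟩ := superIsotherm_of_vanishingBinder hV htend A
  refine hfreq ?_
  filter_upwards [Ioc_mem_nhdsGT hh₀] with h hh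
  exact not_le.2 (hsuper h hh.1 hh.2)

/-- R ABOVE 4945 (glue, lead c3): under the Coulomb antecedent the residual R implies the existing open crux
stmt-CriticalPhenomena-4945 (`LeeYangGap.NearCriticalLeeYangGap`) — S4, R ⟹ B, and G (B ⟹ GAP). -/
theorem nearCriticalLeeYangGap_of_upperIsothermFrequently
    (hC : ∃ c : ℝ, 0 < c ∧ ∀ x : Site 3, x ≠ 0 → c / ‖x‖ ≤ criticalTwoPoint 3 x)
    (hR : ∃ A : ℝ, ∃ᶠ h in 𝓝[>] (0:ℝ),
        magnetizationInField 3 (criticalBeta 3) h ≤ A * h ^ ((1:ℝ) / 5)) :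
    Summit.CriticalPhenomena.Ising3DConformalLimit.Theses.LeeYangGap.NearCriticalLeeYangGap :=
  stub_gapOfBinderNonvanishing (binderNonvanishing_of_upperIsothermFrequently (stub_blockVariance hC) hR)

/-- CONDITIONAL ASSEMBLY (registered as `stub_cruxOfUpperIsothermFrequently`; LANDED p115356 under Theorems/ as the durable
record "R ⟹ crux", file `…OfUpperIsothermFrequently.lean`; no new mathematics): the residual R —
the upper critical isotherm along one sequence of fields, under Coulomb — implies the crux BY NAME. -/
theorem stub_cruxOfUpperIsothermFrequently :
    ((∃ c : ℝ, 0 < c ∧ ∀ x : Site 3, x ≠ 0 → c / ‖x‖ ≤ criticalTwoPoint 3 x) →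
      ∃ A : ℝ, ∃ᶠ h in 𝓝[>] (0:ℝ),
        magnetizationInField 3 (criticalBeta 3) h ≤ A * h ^ ((1:ℝ) / 5)) →
    Summit.CriticalPhenomena.Ising3DConformalLimit.Theses.PerfectScreening.CoulombImpliesNontrivial := by
  -- LANDED p115356 as `PerfectScreeningCoulombImpliesNontrivial.stub_cruxOfUpperIsothermFrequently`
  -- (Theorems/PerfectScreeningCoulombImpliesNontrivialOfUpperIsothermFrequently.lean); re-proved here from the local glue.
  intro hR hC ρ S hρ hlim hnd
  by_contra hU4
  have hV := stub_blockVariance hC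
  exact binderNonvanishing_of_upperIsothermFrequently hV (hR hC) (stub_gaussianKillsBinder hV ρ S hρ hlim hnd hU4)

/-- SECOND CONDITIONAL ASSEMBLY (registered as `stub_cruxOfNearCriticalLeeYangGap`; LANDED p115337 under Theorems/,
file `…OfLeeYangGap.lean`):
the EXISTING open crux `LeeYangGap.NearCriticalLeeYangGap` (stmt-CriticalPhenomena-4945) implies the crux BY NAME
(Camia–Jiang–Newman antitonicity 4947 + transfer 4948, both proved in the tree, move the zero to `β_c`; Newman's
bound gives `g_L ≥ 12/C²` frequently; S4 + S7 give `g_L → 0` under the contradiction hypothesis). -/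
theorem stub_cruxOfNearCriticalLeeYangGap :
    Summit.CriticalPhenomena.Ising3DConformalLimit.Theses.LeeYangGap.NearCriticalLeeYangGap →
      Summit.CriticalPhenomena.Ising3DConformalLimit.Theses.PerfectScreening.CoulombImpliesNontrivial := by
  -- LANDED p115337 as `PerfectScreeningCoulombImpliesNontrivial.stub_cruxOfNearCriticalLeeYangGap`
  -- (Theorems/PerfectScreeningCoulombImpliesNontrivialOfLeeYangGap.lean); re-proved here from the local glue.
  intro hGAP hC ρ S hρ hlim hnd
  by_contra hU4
  have hV := stub_blockVariance hC
  have htend := stub_gaussianKillsBinder hV ρ S hρ hlim hnd hU4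
  obtain ⟨C, hfreq⟩ := hGAP
  have hmono := Summit.CriticalPhenomena.Ising3DConformalLimit.Theorems.monotonicityTransfer_proof
    Summit.CriticalPhenomena.Ising3DConformalLimit.Theorems.firstZeroAntitoneInBeta_proof
  -- at every `L` of the sequence: a zero `θ' ≤ θ` at `β_c`, hence `0 < C` and `12/C² ≤ g_L`
  have hstep : ∀ L : ℕ, (∃ β θ : ℝ, 0 ≤ β ∧ β ≤ criticalBeta 3 ∧ 0 < θ ∧
      θ ^ 2 * plusExpect 3 (criticalBeta 3) 0 (fun σ => (∑ x ∈ box 3 L, spinAt x σ) ^ 2) ≤ C ∧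
      plusExpect 3 β 0 (fun σ => Real.cos (θ * ∑ x ∈ box 3 L, spinAt x σ)) = 0) →
      0 < C ∧ 12 / C ^ 2 ≤
        (3 * (plusExpect 3 (criticalBeta 3) 0 (fun σ => (∑ x ∈ box 3 L, spinAt x σ) ^ 2)) ^ 2 -
            plusExpect 3 (criticalBeta 3) 0 (fun σ => (∑ x ∈ box 3 L, spinAt x σ) ^ 4)) /
          (plusExpect 3 (criticalBeta 3) 0 (fun σ => (∑ x ∈ box 3 L, spinAt x σ) ^ 2)) ^ 2 := by
    intro L ⟨β, θ, hβ, hβc, hθ, hθC, hzero⟩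
    obtain ⟨θ', hθ', hθ'θ, hzero'⟩ := hmono L β (criticalBeta 3) θ hβ hβc le_rfl hθ hzero
    have hVpos := blockVariance_pos' L
    have hθ'C : θ' ^ 2 * plusExpect 3 (criticalBeta 3) 0 (fun σ => (∑ x ∈ box 3 L, spinAt x σ) ^ 2) ≤ C :=
      le_trans (mul_le_mul_of_nonneg_right (pow_le_pow_left₀ hθ'.le hθ'θ 2) hVpos.le) hθC
    obtain ⟨m, n, b, -, -, -, -, -, -, hN⟩ := blockPackage L
    exact ⟨lt_of_lt_of_le (mul_pos (pow_pos hθ' 2) hVpos) hθ'C,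
      blockCoupling_ge hθ' hVpos hθ'C (hN θ' hθ' hzero')⟩
  obtain ⟨L₀, hL₀⟩ := hfreq.exists
  have hCpos : 0 < C := (hstep L₀ hL₀).1
  have hev := htend.eventually (gt_mem_nhds (show (0:ℝ) < 12 / C ^ 2 by positivity))
  obtain ⟨L, hL, hlt⟩ := (hfreq.and_eventually hev).exists
  exact absurd (hstep L hL).2 (not_le.2 hlt)

/-- THE LINE CONCLUDES THE CRUX BY NAME. Under the Coulomb antecedent take any non-degenerate pointwise
limit `(ρ, S)`; if `U₄^S ≡ 0`, S7 gives `g_L → 0` (with the two-sided `L⁵` variance S4), which the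
residual R forbids through the super-isotherm (T1a, T1b, package, S3) — absurd. -/
theorem CoulombImpliesNontrivial_of :
    Summit.CriticalPhenomena.Ising3DConformalLimit.Theses.PerfectScreening.CoulombImpliesNontrivial := by
  intro hC ρ S hρ hlim hnd
  by_contra hU4
  have hV := stub_blockVariance hC
  have htend := stub_gaussianKillsBinder hV ρ S hρ hlim hnd hU4
  exact binderNonvanishing_of_upperIsothermFrequently hV (stub_upperCriticalIsothermFrequently hC) htend

end Summit.CriticalPhenomena.Ising3DConformalLimit.Cruxes.CoulombImpliesNontrivial.SketchPub

end
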